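import Summits.AtomisticToContinuum.Crystallization.Theorems.FreeSplittingCertificatesStrictSplittingRuleP1CellMoments3
import Summits.AtomisticToContinuum.Crystallization.Theorems.FreeSplittingCertificatesStrictSplittingRuleP1Variance
import Summits.AtomisticToContinuum.Crystallization.Theorems.FreeSplittingCertificatesStrictSplittingRuleP1CellDiam

/-!
# `StrictSplittingRule` (stmt-AtomisticToContinuum-12560): the VERTEX-QUADRATURE EXCESS on a real cell — `(|T|/4)Σ_i q(v_i) ≤ ∫_T q(ṽ) + (|T|/16)·½Σ_{i≠j} q(v_i − v_j)` (P1 interpolant object, part 24)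

Route `FreeSplittingCertificates`, crux r3 `StrictSplittingRule` (H12⋆ = `stub_coreJointCoercive`), unit b2b-freesplit-B gen 22.
VALUE = the cell-level inequality of the DEMAND side (item (2''') of HOME FAR-LEMMA-SPEC §17 (c)(B),(e)) for a CONSTANT positive semidefinite
weight `W` on the cell: for the P1 combination `ṽ(y) = Σ_m λ_m(y)·v_m` of four vertex values on the real cell `T = p1RealCell a h (n,π)`
(`λ_m(y) = p1Bary (p1Par n) π m (T⁻¹y − n)`, the hat functions, `p1Interp_eq_sum`),
`(√3a²h/48)·Σ_m q(v_m) ≤ ∫_T q(ṽ(y)) dy + (√3a²h/192)·½·Σ_m Σ_{m'} q(v_m − v_{m'})`, `q = p1Quad3 W`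
— point values at the vertices (lattice bare terms, weight frozen on the cell) are bounded by the cell integral of the interpolant plus
EDGE-DIFFERENCE energy with the constant `|T|/16` (parts 20–23: `∫λ_m = |T|/4`, `∫λ_mλ_{m'} ≤ |T|/16`, variance identity).  Variable weights
enter through the matched split (§17 (e)) or `sup/inf` brackets.  NOT a proof of H12⋆, NOT summit progress.  [folklore]
-/

noncomputable section

open Set Function Metric MeasureTheory Filter Topology
open scoped BigOperators NNReal ENNReal

namespace Summit.AtomisticToContinuum.Crystallization.Theorems.StrictSplittingRuleBirth

open Summit.AtomisticToContinuum.Crystallization.Theorems.PalmUnimodularRigidity.LayeredLawsSelectHcp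

/-- The four barycentric coordinates of every reference piece sum to `1`. -/
theorem sum_p1Bary_eq_one (e : Bool) (π : Fin 6) (p : Fin 3 → ℝ) : ∑ m : Fin 4, p1Bary e π m p = 1 := by
  rw [Fin.sum_univ_four]
  fin_cases e <;> fin_cases π <;> (simp [p1Bary, p1BaryCoef]; try ring)

/-- `p1Quad3 W 0 = 0`. -/
theorem p1Quad3_zero (W : Fin 3 → Fin 3 → ℝ) : p1Quad3 W 0 = 0 := by simp [p1Quad3_eq]

/-- The real cells are compact. -/
theorem isCompact_p1RealCell {a h : ℝ} (ha : a ≠ 0) (hh : h ≠ 0) (i : (ℤ × ℤ × ℤ) × Fin 6) : IsCompact (p1RealCell a h i) := by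
  refine Metric.isCompact_of_isClosed_isBounded (isClosed_p1RealCell a h i) ?_
  refine (Metric.isBounded_closedBall (x := fun j => hcpSite a h i.1 j)
    (r := 2 * |a| + |h|)).subset fun y hy => ?_
  rw [mem_closedBall, dist_eq_norm]
  exact norm_sub_le_of_mem_p1RealCell ha hh hy

/-- The hat function of vertex `m` of the real cell `i = (n,π)`, as a function on `ℝ³`: `λ_m(y) = p1Bary (p1Par n) π m (T⁻¹y − n)`. -/
def p1Lam (a h : ℝ) (i : (ℤ × ℤ × ℤ) × Fin 6) (m : Fin 4) (y : Fin 3 → ℝ) : ℝ :=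
  p1Bary (p1Par i.1) i.2 m (p1ChartInv a h y - p1Vec i.1)

/-- The hat functions restricted to a cell are continuous. -/
theorem continuous_p1Lam (a h : ℝ) (i : (ℤ × ℤ × ℤ) × Fin 6) (m : Fin 4) : Continuous (p1Lam a h i m) := by
  have hc : Continuous fun q : Fin 3 → ℝ => p1Bary (p1Par i.1) i.2 m q := by unfold p1Bary; fun_prop
  exact hc.comp ((continuous_p1ChartInv a h).sub continuous_const)

/-- The four hat functions of a cell sum to `1`. -/
theorem sum_p1Lam_eq_one (a h : ℝ) (i : (ℤ × ℤ × ℤ) × Fin 6) (y : Fin 3 → ℝ) : ∑ m, p1Lam a h i m y = 1 :=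
  sum_p1Bary_eq_one _ _ _

/-- First moments in `p1Lam` form: `∫_{cell} λ_m = √3a²h/48`. -/
theorem setIntegral_p1Lam {a h : ℝ} (ha : 0 < a) (hh : 0 < h) (i : (ℤ × ℤ × ℤ) × Fin 6) (m : Fin 4) :
    ∫ y in p1RealCell a h i, p1Lam a h i m y = √3 * a ^ 2 * h / 48 :=
  setIntegral_p1Bary_p1RealCell ha hh i m

/-- Mixed second moments in `p1Lam` form: `∫_{cell} λ_mλ_{m'} ≤ √3a²h/192` (`m ≠ m'`). -/
theorem setIntegral_p1Lam_mul_le {a h : ℝ} (ha : 0 < a) (hh : 0 < h) (i : (ℤ × ℤ × ℤ) × Fin 6) {m m' : Fin 4} (hne : m ≠ m') :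
    ∫ y in p1RealCell a h i, p1Lam a h i m y * p1Lam a h i m' y ≤ √3 * a ^ 2 * h / 192 :=
  setIntegral_p1Bary_mul_p1RealCell_le ha hh i hne

/-- **THE VERTEX-QUADRATURE EXCESS ON A REAL CELL** (constant PSD weight): for vertex values `v₀..v₃` and the P1 combination
`ṽ(y) = Σ_m λ_m(y) v_m` on the cell, `(√3a²h/48)·Σ_m q(v_m) ≤ ∫_{cell} q(ṽ) + (√3a²h/192)·½·Σ_mΣ_{m'} q(v_m − v_{m'})`.
NOT a proof of H12⋆, NOT summit progress. -/
theorem vertex_quadrature_excess_p1RealCell {a h : ℝ} (ha : 0 < a) (hh : 0 < h) (i : (ℤ × ℤ × ℤ) × Fin 6) (W : Fin 3 → Fin 3 → ℝ)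
    (hW : ∀ w : Fin 3 → ℝ, 0 ≤ p1Quad3 W w) (v : Fin 4 → Fin 3 → ℝ) :
    √3 * a ^ 2 * h / 48 * ∑ m, p1Quad3 W (v m) ≤
      (∫ y in p1RealCell a h i, p1Quad3 W (fun k => ∑ m, p1Lam a h i m y * v m k)) +
        √3 * a ^ 2 * h / 192 * (1 / 2 * ∑ m, ∑ m', p1Quad3 W (v m - v m')) := by
  have hK := isCompact_p1RealCell ha.ne' hh.ne' i
  have hmeas : MeasurableSet (p1RealCell a h i) := (isClosed_p1RealCell a h i).measurableSet
  have hcl : ∀ m, Continuous (p1Lam a h i m) := continuous_p1Lam a h i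
  -- integrability of the pieces
  have iA : ∀ m, IntegrableOn (fun y => p1Lam a h i m y * p1Quad3 W (v m)) (p1RealCell a h i) volume := fun m =>
    ((hcl m).mul continuous_const).continuousOn.integrableOn_compact hK
  have iB : ∀ m m', IntegrableOn (fun y => p1Lam a h i m y * p1Lam a h i m' y * p1Quad3 W (v m - v m')) (p1RealCell a h i) volume :=
    fun m m' => (((hcl m).mul (hcl m')).mul continuous_const).continuousOn.integrableOn_compact hK
  -- pointwise variance identity
  have hpt : ∀ y, (∑ m, p1Lam a h i m y * p1Quad3 W (v m)) - p1Quad3 W (fun k => ∑ m, p1Lam a h i m y * v m k) =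
      1 / 2 * ∑ m, ∑ m', p1Lam a h i m y * p1Lam a h i m' y * p1Quad3 W (v m - v m') :=
    fun y => p1_variance_identity W (fun m => p1Lam a h i m y) (sum_p1Lam_eq_one a h i y) v
  -- integrate: the quadrature term
  have hA : ∫ y in p1RealCell a h i, ∑ m, p1Lam a h i m y * p1Quad3 W (v m) = √3 * a ^ 2 * h / 48 * ∑ m, p1Quad3 W (v m) := by
    rw [integral_finsetSum _ fun m _ => iA m, Finset.mul_sum]
    refine Finset.sum_congr rfl fun m _ => ?_
    rw [integral_mul_const, setIntegral_p1Lam ha hh i m]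
  -- integrate: the defect term, bounded by the second moments
  have hB' : ∑ m, ∫ y in p1RealCell a h i, ∑ m', p1Lam a h i m y * p1Lam a h i m' y * p1Quad3 W (v m - v m') ≤
      ∑ m : Fin 4, ∑ m' : Fin 4, √3 * a ^ 2 * h / 192 * p1Quad3 W (v m - v m') := by
    refine Finset.sum_le_sum fun m _ => ?_
    rw [integral_finsetSum _ fun m' _ => iB m m']
    refine Finset.sum_le_sum fun m' _ => ?_
    rw [integral_mul_const]
    by_cases hmm : m = m'
    · subst hmm
      simp [p1Quad3_zero]
    · exact mul_le_mul_of_nonneg_right (setIntegral_p1Lam_mul_le ha hh i hmm) (hW _)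
  have hB : ∫ y in p1RealCell a h i, 1 / 2 * ∑ m, ∑ m', p1Lam a h i m y * p1Lam a h i m' y * p1Quad3 W (v m - v m') ≤
      √3 * a ^ 2 * h / 192 * (1 / 2 * ∑ m, ∑ m', p1Quad3 W (v m - v m')) := by
    rw [integral_const_mul, integral_finsetSum _ fun m _ => integrable_finsetSum _ fun m' _ => iB m m']
    have e : ∑ m : Fin 4, ∑ m' : Fin 4, √3 * a ^ 2 * h / 192 * p1Quad3 W (v m - v m') =
        √3 * a ^ 2 * h / 192 * ∑ m : Fin 4, ∑ m' : Fin 4, p1Quad3 W (v m - v m') := by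
      simp_rw [Finset.mul_sum]
    nlinarith [hB', e]
  -- the interpolant integrand is integrable (continuous on compact)
  have iQ : IntegrableOn (fun y => p1Quad3 W (fun k => ∑ m, p1Lam a h i m y * v m k)) (p1RealCell a h i) volume := by
    have : Continuous fun y => p1Quad3 W (fun k => ∑ m, p1Lam a h i m y * v m k) := by
      simp only [p1Quad3_eq, Fin.sum_univ_four]
      fun_prop
    exact this.continuousOn.integrableOn_compact hK
  have iS : IntegrableOn (fun y => ∑ m, p1Lam a h i m y * p1Quad3 W (v m)) (p1RealCell a h i) volume :=
    integrable_finsetSum _ fun m _ => iA m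
  have hdiff : (∫ y in p1RealCell a h i, ∑ m, p1Lam a h i m y * p1Quad3 W (v m)) -
      ∫ y in p1RealCell a h i, p1Quad3 W (fun k => ∑ m, p1Lam a h i m y * v m k) =
      ∫ y in p1RealCell a h i, 1 / 2 * ∑ m, ∑ m', p1Lam a h i m y * p1Lam a h i m' y * p1Quad3 W (v m - v m') := by
    rw [← integral_sub iS iQ]
    exact setIntegral_congr_fun hmeas fun y _ => hpt y
  linarith [hA, hB, hdiff]

end Summit.AtomisticToContinuum.Crystallization.Theorems.StrictSplittingRuleBirth
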